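import Summits.ResolutionOfSingularities.ResolutionOfSingularities.Theorems.WildASPairLU2
import HarnessLib

/-!
# WildASPairLU (3/5) — GENERATION at `t ≡ 1` and the RESCALING LEMMA (`λ′` frames from two-exponent frames)

Node «ASPairCollapse» (decomp-res lens-1 g35), tree file 3/5.  Two kernel bricks of the engine:
* `exists_sum_mul_update_sub_one` — in the monomial chart `B[y]` with exactly one unit parameter `y_{j₂} = t ≡ 1`
  (`v(t − 1) < 1`) the frame `y[j₂ ↦ t − 1]` GENERATES the centre: an element of the centre is `∑_{j≠j₂} r_j y_j + q/g`
  with `q = P(t) ∈ B[t]` (`exists_decomp_of_mem_maximalIdeal_locAtCentre` by name), `P = (X − 1)Q + P(1)` and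
  `P(1) ∈ 𝔪_B ⊆ ∑_{j≠j₂} y_j B[y]`.
* `exists_logDiagonal_frame_of_rescale` — a frame `ỹ` of `T′` generating the centre of `T′_𝔪′` with TWO-EXPONENT twists
  `σ ỹ_j = ỹ_j U₁^{P j} U₂^{Q j}` (`U₁ = 1 + ỹ_{j₁}`, `Q j₁ = 0`) and a unit `c ∈ T′` with `σ c = c U₁^α U₂⁻¹` is RESCALED
  to the `λ′`-frame `x′⁺_j = ỹ_j c^{Q j}`: `σ x′⁺_j = x′⁺_j (1 + ỹ_{j₁})^{P j + α Q j}` — ONE principal unit, MONOMIAL pivot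
  `η = ỹ_{j₁} = x′⁺_{j₁}`: exactly the model-level block of the kind `λ′ = WildLogDiagonalUnluckyAbove`.
-/

noncomputable section

open IsLocalRing Polynomial Literature.AlgebraicGeometry.Resolution
open Summit.ResolutionOfSingularities.ResolutionOfSingularities.Theorems.InvariantDescentLU
open Summit.ResolutionOfSingularities.ResolutionOfSingularities.Theorems.WildReflectionLU
open Summit.ResolutionOfSingularities.ResolutionOfSingularities.Theorems.WildLogDiagonalLU

universe u

namespace Summit.ResolutionOfSingularities.ResolutionOfSingularities.Theorems.WildASPairLU

variable {E : Type u} [Field E]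

/-- `∏_j f_j^{[i = j]} = f_i`. [folklore] -/
theorem prod_pow_indicator {d : ℕ} (f : Fin d → E) (i : Fin d) :
    ∏ j, f j ^ (if i = j then 1 else 0) = f i := by
  rw [Finset.prod_eq_single_of_mem i (Finset.mem_univ i)
    (fun j _ hj => by rw [if_neg (Ne.symm hj), pow_zero]), if_pos rfl, pow_one]

/-- Every element of `B[u]` is a polynomial in `u` over `B`. [folklore] -/
theorem exists_eq_aeval_of_mem_closure (B : Subring E) (u : E) {q : E}
    (hq : q ∈ Subring.closure ((B : Set E) ∪ {u})) : ∃ P : Polynomial B, q = aeval u P := by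
  induction hq using Subring.closure_induction with
  | mem z hz =>
      rcases hz with hz | hz
      · exact ⟨C ⟨z, hz⟩, by rw [aeval_C]; rfl⟩
      · exact ⟨X, by rw [Set.mem_singleton_iff.mp hz, aeval_X]⟩
  | zero => exact ⟨0, by rw [map_zero]⟩
  | one => exact ⟨1, by rw [map_one]⟩
  | add a b _ _ ha hb =>
      obtain ⟨P, rfl⟩ := ha
      obtain ⟨Q, rfl⟩ := hb
      exact ⟨P + Q, by rw [map_add]⟩
  | neg a _ ha =>
      obtain ⟨P, rfl⟩ := ha
      exact ⟨-P, by rw [map_neg]⟩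
  | mul a b _ _ ha hb =>
      obtain ⟨P, rfl⟩ := ha
      obtain ⟨Q, rfl⟩ := hb
      exact ⟨P * Q, by rw [map_mul]⟩

/-- A polynomial over `B` evaluated at `u` lies in `B[u]`. [folklore] -/
theorem aeval_mem_closure (B : Subring E) (u : E) (P : Polynomial B) :
    aeval u P ∈ Subring.closure ((B : Set E) ∪ {u}) := by
  have huC : u ∈ Subring.closure ((B : Set E) ∪ {u}) := Subring.subset_closure (Or.inr rfl)
  have hBC : ∀ b : B, (b : E) ∈ Subring.closure ((B : Set E) ∪ {u}) := fun b =>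
    Subring.subset_closure (Or.inl b.2)
  rw [aeval_eq_sum_range]
  refine Subring.sum_mem _ fun i _ => ?_
  rw [Algebra.smul_def]
  show ((P.coeff i : B) : E) * u ^ i ∈ Subring.closure ((B : Set E) ∪ {u})
  exact (Subring.closure ((B : Set E) ∪ {u})).mul_mem (hBC (P.coeff i))
    ((Subring.closure ((B : Set E) ∪ {u})).pow_mem huC i)

section Gen

variable (O : ValuationSubring E)

set_option maxHeartbeats 800000 in
/-- **GENERATION AT `t ≡ 1`.**  In the monomial chart `B[y] ⊆ O` (`B ⊆ O` a subring, `𝔪_B := 𝔪_O ∩ B`-part moved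
into the `y_j` of positive value: `hmB`) with exactly ONE unit parameter `y_{j₂}` (`v(y_j) < 1` for `j ≠ j₂`) which is
`≡ 1` (`v(y_{j₂} − 1) < 1`), every element of positive value of `(B[y])_𝔪′` is `∑_j c_j·y[j₂ ↦ y_{j₂} − 1]_j` with
`c_j ∈ (B[y])_𝔪′`: the frame `y[j₂ ↦ y_{j₂} − 1]` generates the centre.  Proof: `exists_decomp_of_mem_maximalIdeal_locAtCentre`
(`z = ∑ r_j y_j + q/g`, `q ∈ B[y_{j₂}]`), `q = P(y_{j₂})`, `P = (X − 1)·Q + P(1)` and `P(1) ∈ 𝔪_B`.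
[cite: CossartPiltant2008, proof of Prop. 8.1 (HAL p. 23)] -/
theorem exists_sum_mul_update_sub_one {B : Subring E} (hBO : B ≤ O.toSubring)
    {d : ℕ} {y : Fin d → E} (hyO : ∀ j, y j ∈ O) {j₂ : Fin d}
    (hlt : ∀ j, j ≠ j₂ → O.valuation (y j) < 1) (hunit : O.valuation (y j₂) = 1)
    (hone : O.valuation (y j₂ - 1) < 1)
    (hmB : ∀ a ∈ B, O.valuation a < 1 → ∃ r : Fin d → E,
      (∀ j, r j ∈ Subring.closure ((B : Set E) ∪ Set.range y)) ∧ (∀ j, O.valuation (y j) = 1 → r j = 0) ∧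
      a = ∑ j, r j * y j)
    {b : E} (hb : b ∈ locAtCentre (Subring.closure ((B : Set E) ∪ Set.range y)) O) (hbv : O.valuation b < 1) :
    ∃ c : Fin d → E, (∀ j, c j ∈ locAtCentre (Subring.closure ((B : Set E) ∪ Set.range y)) O) ∧
      b = ∑ j, c j * Function.update y j₂ (y j₂ - 1) j := by
  classical
  set Tc : Subring E := Subring.closure ((B : Set E) ∪ Set.range y) with hTcdef
  set Bp : Subring E := locAtCentre Tc O with hBpdef
  set u : E := y j₂ with hudef
  have hTcO : Tc ≤ O.toSubring :=
    Subring.closure_le.mpr (Set.union_subset hBO (by rintro _ ⟨j, rfl⟩; exact hyO j))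
  have hTB : Tc ≤ Bp := le_locAtCentre Tc O
  have hBTc : B ≤ Tc := fun a ha => Subring.subset_closure (Or.inl ha)
  have huTc : u ∈ Tc := Subring.subset_closure (Or.inr ⟨j₂, rfl⟩)
  have hval : ∀ z ∈ Tc, O.valuation z ≤ 1 := fun z hz => (O.valuation_le_one_iff z).mpr (hTcO hz)
  obtain ⟨r, hr, hr0, q, hq, hqv, g, hg, hgv, hbeq⟩ :=
    exists_decomp_of_mem_maximalIdeal_locAtCentre O B hBO y hyO hb hbv
  -- `q ∈ B[u]`, `u = y_{j₂}` the only unit parameter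
  have hq' : q ∈ Subring.closure ((B : Set E) ∪ {u}) := by
    refine Subring.closure_mono (Set.union_subset_union_right _ ?_) hq
    rintro _ ⟨⟨i, hi⟩, rfl⟩
    have hi2 : i = j₂ := by
      by_contra h
      exact (hlt i h).ne hi
    subst hi2
    rfl
  have hBu : Subring.closure ((B : Set E) ∪ {u}) ≤ Tc :=
    Subring.closure_mono (Set.union_subset_union_right _ (by
      rintro _ h; rw [Set.mem_singleton_iff.mp h]; exact ⟨j₂, rfl⟩))
  obtain ⟨P, hP⟩ := exists_eq_aeval_of_mem_closure B u hq'
  obtain ⟨Q, hQ⟩ := X_sub_C_dvd_sub_C_eval (p := P) (a := (1 : B))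
  have hQu : aeval u Q ∈ Tc := hBu (aeval_mem_closure B u Q)
  have hdecomp : q = (u - 1) * aeval u Q + ((P.eval 1 : B) : E) := by
    have h := congrArg (aeval u) hQ
    rw [map_sub, map_mul, map_sub, aeval_X, aeval_C, aeval_C, map_one] at h
    rw [hP]
    have h1 : (algebraMap B E) (eval 1 P) = ((P.eval 1 : B) : E) := rfl
    rw [h1] at h
    linear_combination h
  -- `P(1) ∈ 𝔪_B ⊆ ∑_{j ≠ j₂} y_j B[y]`
  have hP1v : O.valuation (((P.eval 1 : B) : E)) < 1 := by
    have e : ((P.eval 1 : B) : E) = q - (u - 1) * aeval u Q := by rw [hdecomp]; ring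
    rw [e]
    refine lt_of_le_of_lt (Valuation.map_sub _ _ _) (max_lt hqv ?_)
    rw [map_mul]
    calc O.valuation (u - 1) * O.valuation (aeval u Q) ≤ O.valuation (u - 1) * 1 := by
          gcongr
          exact hval _ hQu
      _ < 1 := by rw [mul_one]; exact hone
  obtain ⟨s, hs, hs0, hseq⟩ := hmB _ (P.eval 1).2 hP1v
  -- assemble the coefficients
  have hg0 : g ≠ 0 := ne_zero_of_valuation_eq_one hgv
  have hginv : ∀ z ∈ Tc, z / g ∈ Bp := fun z hz => mem_locAtCentre_iff.mpr ⟨z, hz, g, hg, hgv, rfl⟩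
  refine ⟨Function.update (fun j => r j + s j / g) j₂ (aeval u Q / g), fun j => ?_, ?_⟩
  · by_cases hj : j = j₂
    · rw [hj, Function.update_self]
      exact hginv _ hQu
    · rw [Function.update_of_ne hj]
      exact Bp.add_mem (hr j) (hginv _ (hs j))
  · have key : ∀ j, Function.update (fun j => r j + s j / g) j₂ (aeval u Q / g) j *
        Function.update y j₂ (y j₂ - 1) j =
        (r j + s j / g) * y j + (if j = j₂ then aeval u Q / g * (u - 1) else 0) := by
      intro j
      by_cases hj : j = j₂
      · subst hj
        rw [Function.update_self, Function.update_self, if_pos rfl, hr0 _ hunit, hs0 _ hunit]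
        ring
      · rw [Function.update_of_ne hj, Function.update_of_ne hj, if_neg hj, add_zero]
    rw [Finset.sum_congr rfl fun j _ => key j, Finset.sum_add_distrib, Finset.sum_ite_eq' Finset.univ j₂,
      if_pos (Finset.mem_univ _), hbeq, hdecomp, hseq]
    have e1 : ∑ j, (r j + s j / g) * y j = ∑ j, r j * y j + (∑ j, s j * y j) / g := by
      rw [Finset.sum_div, ← Finset.sum_add_distrib]
      exact Finset.sum_congr rfl fun j _ => by ring
    rw [e1]
    ring

end Gen

/-! ## Rescaling a two-exponent frame to a `λ′` frame -/
section Rescale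

variable (O : ValuationSubring E) {T' : Subring E} {σ : E ≃+* E}

set_option maxHeartbeats 1600000 in
/-- **THE RESCALING LEMMA.**  Let `T′ ⊆ O` carry a frame `ỹ₁, …, ỹ_d ∈ T′ ∩ 𝔪_O ∖ 0` generating the centre of
`B′ = T′_𝔪′` (`dim B′ = d`), with TWO-EXPONENT twists `σ ỹ_j = ỹ_j·U₁^{P j}·U₂^{Q j}` where `U₁ = 1 + ỹ_{j₁}`, `U₂` has
value `1` and `Q j₁ = 0`, and let `c ∈ T′` be a unit with `σ c = c·U₁^α·U₂⁻¹`.  Then `x′⁺_j := ỹ_j·c^{Q j}` is a frame of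
fractions of `T′` generating the centre with `σ x′⁺_j = x′⁺_j·(1 + η)^{P j + α Q j}`, `η = ỹ_{j₁} = x′⁺_{j₁} ∈ T′` a
MONOMIAL PIVOT (`w = 1`) — the model-level block of `λ′ = WildLogDiagonalUnluckyAbove` on `T′` (with `x = x′⁺`,
`A = 1`), provided some `P j + α Q j ≠ 0`. [folklore; cite: KiralyLutkebohmert2013, Ex. 6, p. 66] -/
theorem exists_logDiagonal_frame_of_rescale (hT'O : T' ≤ O.toSubring)
    {d : ℕ} {y : Fin d → E} (hyT : ∀ j, y j ∈ T') (hy0 : ∀ j, y j ≠ 0) (hyv : ∀ j, O.valuation (y j) < 1)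
    (hgen : ∀ b ∈ locAtCentre T' O, O.valuation b < 1 →
      ∃ c : Fin d → E, (∀ j, c j ∈ locAtCentre T' O) ∧ b = ∑ j, c j * y j)
    (hdim : ringKrullDim (locAtCentre T' O) = d)
    {U₂ c : E} {P Q : Fin d → ℤ} {α : ℤ} {j₁ : Fin d}
    (hU₂v : O.valuation U₂ = 1) (hcT : c ∈ T') (hcv : O.valuation c = 1)
    (hσc : σ c = c * (1 + y j₁) ^ α * U₂⁻¹)
    (htw : ∀ j, σ (y j) = y j * (1 + y j₁) ^ P j * U₂ ^ Q j) (hQ : Q j₁ = 0) (hne : ∃ j, P j + α * Q j ≠ 0) :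
    ∃ x x' : Fin d → E, ∃ A : Fin d → Fin d → ℕ, ∃ η w : E, ∃ a' : Fin d → ℕ, ∃ N : Fin d → ℤ,
      ringKrullDim (locAtCentre T' O) = d ∧
      (∀ i, x i ∈ locAtCentre T' O ∧ O.valuation (x i) < 1) ∧
      (∀ b ∈ locAtCentre T' O, O.valuation b < 1 →
        ∃ c : Fin d → E, (∀ i, c i ∈ locAtCentre T' O) ∧ b = ∑ i, c i * x i) ∧
      (∀ j, x' j ≠ 0 ∧ x' j ∈ O ∧ O.valuation (x' j) < 1 ∧ ∃ a b : E, a ∈ T' ∧ b ∈ T' ∧ x' j = a / b) ∧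
      (∀ i, x i = ∏ j, x' j ^ A i j) ∧
      (η ∈ T' ∧ O.valuation η < 1 ∧ w ∈ locAtCentre T' O ∧ O.valuation w = 1 ∧ η = w * ∏ j, x' j ^ a' j) ∧
      (∀ j, σ (x' j) = x' j * (1 + η) ^ N j) ∧ ∃ j, N j ≠ 0 := by
  classical
  set B' : Subring E := locAtCentre T' O with hB'def
  have hT'B' : T' ≤ B' := le_locAtCentre T' O
  have hB'O : B' ≤ O.toSubring := locAtCentre_le hT'O
  have hc0 : c ≠ 0 := ne_zero_of_valuation_eq_one hcv
  have hU20 : U₂ ≠ 0 := ne_zero_of_valuation_eq_one hU₂v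
  have hU1v : O.valuation (1 + y j₁) = 1 := valuation_one_add_eq_one O (hyv j₁)
  have hU10 : (1 + y j₁) ≠ 0 := ne_zero_of_valuation_eq_one hU1v
  have hcB' : c ∈ B' := hT'B' hcT
  have hczB' : ∀ n : ℤ, c ^ n ∈ B' := zpow_mem_of_inv_mem B' hcB' (inv_mem_locAtCentre hcB' hcv)
  have hvcz : ∀ n : ℤ, O.valuation (c ^ n) = 1 := fun n => by rw [map_zpow₀, hcv, one_zpow]
  set x' : Fin d → E := fun j => y j * c ^ Q j with hx'def
  have hx'v : ∀ j, O.valuation (x' j) < 1 := fun j => by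
    show O.valuation (y j * c ^ Q j) < 1
    rw [map_mul, hvcz, mul_one]
    exact hyv j
  have hx'B' : ∀ j, x' j ∈ B' := fun j => B'.mul_mem (hT'B' (hyT j)) (hczB' _)
  refine ⟨x', x', fun i j => if i = j then 1 else 0, y j₁, 1, fun j => if j₁ = j then 1 else 0,
    fun j => P j + α * Q j, hdim, fun i => ⟨hx'B' i, hx'v i⟩, fun b hb hbv => ?_, fun j => ?_,
    fun i => (prod_pow_indicator x' i).symm, ⟨hyT j₁, hyv j₁, B'.one_mem, map_one _, ?_⟩, fun j => ?_, hne⟩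
  · -- generation: `b = ∑ c₀_j ỹ_j = ∑ (c₀_j c^{−Q j})·x′⁺_j`
    obtain ⟨c₀, hc₀, hbeq⟩ := hgen b hb hbv
    refine ⟨fun j => c₀ j * c ^ (-Q j), fun j => B'.mul_mem (hc₀ j) (hczB' _), ?_⟩
    rw [hbeq]
    refine Finset.sum_congr rfl fun j _ => ?_
    have e : c ^ (-Q j) * c ^ Q j = 1 := by rw [← zpow_add₀ hc0, neg_add_cancel, zpow_zero]
    calc c₀ j * y j = c₀ j * y j * (c ^ (-Q j) * c ^ Q j) := by rw [e, mul_one]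
      _ = c₀ j * c ^ (-Q j) * (y j * c ^ Q j) := by ring
  · -- frame clauses
    obtain ⟨a, b, ha, hb, hab⟩ := exists_mul_zpow_eq_div T' (hyT j) hcT (Q j)
    exact ⟨mul_ne_zero (hy0 j) (zpow_ne_zero _ hc0), hB'O (hx'B' j), hx'v j, a, b, ha, hb, hab⟩
  · -- pivot shape: `η = 1·∏ x′⁺_j^{[j = j₁]} = x′⁺_{j₁} = ỹ_{j₁}·c^0`
    rw [one_mul, prod_pow_indicator]
    show y j₁ = y j₁ * c ^ Q j₁
    rw [hQ, zpow_zero, mul_one]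
  · -- the twist
    show σ (y j * c ^ Q j) = y j * c ^ Q j * (1 + y j₁) ^ (P j + α * Q j)
    rw [map_mul, map_zpow₀, htw j, hσc, mul_zpow, mul_zpow, inv_zpow, ← zpow_mul, zpow_add₀ hU10]
    field_simp

end Rescale

end Summit.ResolutionOfSingularities.ResolutionOfSingularities.Theorems.WildASPairLU

end
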